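/-
Copyright (c) 2026 the pub-hodgecm-mathlib formalisation cell (harness21).  Prover seats hodgecm-mathlib-LH4-p12 (g9) (author of record, cand v1 eb877444f83d3eed) and
hodgecm-mathlib-LH4-p15 (g3) (A5 owner; v2: the unit letter's CONVERSE added), req620 Track A «(D-RAM) FOUR-FRAME» squad (STAGE-1b, row (2) of the piece `f_{T₊}`, the (β₂) road
(R-36) «PURE-CELL LEDGER»; K6 desk LH4-p16 (g3) WORD #17∕#22 A5 «THE TOP CELL IDENTITY»; the TOP-chart twin of the desk's ★ A1 p864708 `…RowInsideChartLetters`), 2026-09-05.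
-/
import Summits.HodgeConjecture.HodgeConjecture.Theorems.F0P3cDyRamRowInsideChartLetters      -- ★ A1 p864708 (LH4-p16 (g3)): `v_mul_add_map_mul_eq`, `v_map_snd_eq` BY NAME; brings ★ p864373 `exists_refPair_of_frame`, ★ `exists_eq_map_add_map_mul_of_v_le_one`
import Summits.HodgeConjecture.HodgeConjecture.Theorems.F0P3cDyRamAffineLabelOnShellIff       -- ★ (LH4-p15 (g3)) `exists_affineLabel_of_coords_onShell_iff` (★ p864616∕p864854 «DICT-NX» with the unit letter as an IFF)
import HarnessLib

/-!
# Crux `H413`, line LH4 «(D-RAM) FOUR-FRAME» — STAGE-1b, row (2), the (β₂) road (R-36), K6 road A5: «THE ROW'S TOP CHART AND ITS LABEL LETTERS» — ONCE per live row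
# `2b + d%2 = m` with a window `m + 2N = jl`, `N ≥ 1`: a reference pair `(κ₀, ξ₀)` with `|κ₀| = 1`, `|ξ₀| = exp 2N` (the TOP radius), the `(1, α)`-coordinates `μ = jE μ_a + jE μ_b·α`,
# `jE R₀ = Tr_ρ(ακ₀)`, `jE γ₀ = ξ₀(α − ρα)` with `|μ_a + μ_bR₀| = |μ_bγ₀| = |ϖ|^m` (`g = 0`), and the ON-SHELL dictionary `(α₁, γ₁, haff)` WITH its unit letter — F1b-top's chart binders
# ALL AT ONCE (the desk's ★ A1 p864708 `exists_rowInsideChart_letters` is the inside chart `|ξ₀| = exp 2(N − 1)`, `g = 1`)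

Cell `hodgecm-mathlib` (D-0151), FLOOR 0, crux item H413 = `stmt-HodgeConjecture-24833`, route of record `HCCMUnconditional`; squad F0∕P3c∕LH4; lane
`--supports stmt-HodgeConjecture-24833 --as helper` (count-neutral; pays NO tier-0 row).  THEOREMS ONLY (no `def`, no instance, no notation, no `sorry`, default heartbeats);
★-only imports; states NO law; (β₂) stays a HYPOTHESIS.  Hypotheses = ★ A1's VERBATIM (the CORE∕FLIPT letters' frame: sheet datum, `jE`-letters, `ρ`, `Θρ = ρΘ`, `α`, `|α − ρα| = 1`,
the `M`-datum `hDM`, `#𝓀[M] = q²`, `hσres`, `hτ`, the line `hm hjl`, the row `hbm : 2 * b + d % 2 = m`, `hN1 : 1 ≤ N`, `hNjl : m + 2 * N = jl`).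
THIS FILE, ONE theorem:
* HEAD `exists_rowTopChart_letters` — `∃ κ₀ ξ₀ μa μb R₀ γ₀ α₁ γ₁` with ★ A1's conjuncts in order, re-sized to the top: `|ξ₀| = exp (2 * N)`, `|ξ₀|·|jEϖ|^jl = |jEϖ|^(2 * b + d % 2)`
  (F1b-top's `hξv`), `|μa + μbR₀| = |ϖ|^m`, `|μbγ₀| = |ϖ|^m`, `σα₁ = α₁`, `|α₁| = 1`, `σγ₁ = γ₁`, `|γ₁| = 1`, `|γ₁| ≤ 1` (F1b-top's `hγ₁1`), the UNIT LETTER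
  `∀ V, σV = V → |V| ≤ 1 → |μa + μb·(R₀ + V·γ₀)| = |ϖ|^(2b + d%2) → |α₁ + γ₁V| = 1` (F1b-top's `hαγ`), ITS CONVERSE `… → |α₁ + γ₁V| = 1 → |μa + μb·(R₀ + V·γ₀)| = |ϖ|^(2b + d%2)`
  (v2, LH4-p15: the `NX`-sphere of F1b-top IS the unit-label sphere of ★ (g-top) p864688 — A5's `hs`), and the ON-SHELL dictionary (F1b-top's `haff`, byte-identical).
  Proof = ★ A1's with ★ `exists_refPair_of_frame` at `n := N`, the sizes by ★ A1 §1∕§2 BY NAME, and ★ `exists_affineLabel_of_coords_onShell_iff` at `g := 0`.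
WHAT IS NOT CLAIMED: any count, any law; the top cell's law (F1b-top) and identity (A5) consume this by name.
HONEST LABEL.  Count-neutral valuation bookkeeping; nothing printed is asserted; no census law is stated; ‹CORE›∕‹CORE-3›∕‹CORE-ODD›∕β₂ `stub_law_cleanSgn₂` UNPROVED; `HC_CM` is proved
only modulo the 7 printed citations (2 remaining named inputs: hLiu418 = `stmt-HodgeConjecture-24832`, h413 = `stmt-HodgeConjecture-24833`) until rung 0 closes.
## References
* [Rogawski1990] J. D. Rogawski, *Automorphic Representations of Unitary Groups in Three Variables*, Ann. of Math. Stud. 123 (1990): §4.9 Prop. 4.9.1 (b) p. 55.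
* [Serre1979] J.-P. Serre, *Local Fields*, GTM 67 (1979): Ch. I §6 Prop. 18; Ch. V §3 Cor. 3 pp. 85–87; Ch. XIV §2–§3.
* [Kottwitz1986BaseChangeUnits] R. E. Kottwitz, Compositio Math. 60 (1986): §1 pp. 240–241.
-/

set_option autoImplicit false

noncomputable section

namespace Summit.HodgeConjecture.HodgeConjecture.Cruxes.H413.F0P3cDyRamRowTopChartLetters

open scoped Valued WithZero
open WithZero
open Literature.NumberTheory.Automorphic.UnitaryThreeFourFrame (IsRamifiedQuadraticDatum normSign)
open Summit.HodgeConjecture.HodgeConjecture.Cruxes.H413.F0P3cDyRamFourFramePieces (mstarOfRecord)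
open Summit.HodgeConjecture.HodgeConjecture.Cruxes.H413.F0P3cDyRamRamKFrameClassLetters (exists_refPair_of_frame)
open Summit.HodgeConjecture.HodgeConjecture.Cruxes.H413.F0P3cDyRamConeCellCleanRegimeBoundary (exists_eq_map_add_map_mul_of_v_le_one)
open Summit.HodgeConjecture.HodgeConjecture.Cruxes.H413.F0P3cDyRamAffineLabelOnShellIff (exists_affineLabel_of_coords_onShell_iff)
open Summit.HodgeConjecture.HodgeConjecture.Cruxes.H413.F0P3cDyRamRowInsideChartLetters (v_mul_add_map_mul_eq v_map_snd_eq)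

variable {E M : Type} [Field E] [Valued E ℤᵐ⁰] [Field M] [Valued M ℤᵐ⁰] {ρ Θ : M →+* M} {α : M}

/-- **HEAD — «THE ROW'S TOP CHART AND ITS LABEL LETTERS».**  In the CORE∕FLIPT letters' frame (★ A1's hypotheses VERBATIM), for the live row `2b + d%2 = m` and a window `m + 2N = jl`,
`N ≥ 1`: a reference pair `(κ₀, ξ₀) ⊂ Fix Θ` of the line `Tr_ρ = 1` with `|κ₀| = 1`, `ρξ₀ = −ξ₀`, `|ξ₀| = exp 2N` (`|ξ₀|·|jEϖ|^{jl} = |jEϖ|^{2b+d%2}`), coordinates `μ = jE μ_a + jE μ_b α`,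
`jE R₀ = Tr_ρ(ακ₀)`, `jE γ₀ = ξ₀(α − ρα)` with `|μ_a + μ_bR₀| = |μ_bγ₀| = |ϖ|^m`, and `σ`-fixed `α₁, γ₁`, `|α₁| = |γ₁| = 1`, with the UNIT LETTER on the shell, ITS CONVERSE (unit label ⇒
on the shell; v2) and the ON-SHELL affine-sign dictionary of ★ p864616 ED. 2. [cite: Rogawski1990, §4.9 Prop. 4.9.1 (b) p. 55] [cite: Serre1979, Ch. V §3 Cor. 3 pp. 85–87] [cite: Serre1979, Ch. XIV §2–§3] -/
theorem exists_rowTopChart_letters [CompleteSpace E] [Finite 𝓀[E]] [CompleteSpace M] [Finite 𝓀[M]]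
    {σ : E →+* E} {ϖ : E} {d tE : ℕ} (hD : IsRamifiedQuadraticDatum σ ϖ d tE)
    (jE : E →+* M) (hjiso : ∀ a, Valued.v (jE a) = Valued.v a) (hjfix : ∀ z, ρ z = z ↔ ∃ c, jE c = z) (hΘj : ∀ c, Θ (jE c) = jE (σ c))
    (hρρ : ∀ x, ρ (ρ x) = x) (hvρ : ∀ x, Valued.v (ρ x) = Valued.v x) (hΘρ : ∀ x, Θ (ρ x) = ρ (Θ x))
    (hα : ρ α ≠ α) (hα1 : Valued.v α ≤ 1) (hint : ∀ z : M, Valued.v z ≤ 1 → Valued.v ((z - ρ z) / (α - ρ α)) ≤ 1)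
    (hU : Valued.v (α - ρ α) = 1) (hDM : IsRamifiedQuadraticDatum Θ (jE ϖ) d tE)
    {q : ℕ} (hq : Nat.card 𝓀[M] = q ^ 2)
    (hσres : ∀ z : M, ρ z = z → Valued.v z ≤ 1 → Valued.v (Θ z - z) < 1) (hτ : Valued.v (α - Θ α) < 1)
    (lam : M) (u00 : E) {m jl : ℕ} (hm : Valued.v (lam - jE u00) = exp (-(m : ℤ)))
    (hjl : Valued.v ((lam - jE u00) - ρ (lam - jE u00)) = exp (-(jl : ℤ)))
    {b : ℕ} (hbm : 2 * b + d % 2 = m) {N : ℕ} (hN1 : 1 ≤ N) (hNjl : m + 2 * N = jl) :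
    ∃ (κ₀ ξ₀ : M) (μa μb R₀ γ₀ α₁ γ₁ : E),
      κ₀ + ρ κ₀ = 1 ∧ Θ κ₀ = κ₀ ∧ Valued.v κ₀ ≤ 1 ∧ Valued.v κ₀ = 1 ∧ ρ ξ₀ = -ξ₀ ∧ Θ ξ₀ = ξ₀ ∧ ξ₀ ≠ 0 ∧
      Valued.v ξ₀ = exp (2 * (N : ℤ)) ∧ Valued.v ξ₀ * Valued.v (jE ϖ) ^ jl = Valued.v (jE ϖ) ^ (2 * b + d % 2) ∧
      lam - jE u00 = jE μa + jE μb * α ∧ jE R₀ = α * κ₀ + ρ (α * κ₀) ∧ jE γ₀ = ξ₀ * (α - ρ α) ∧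
      Valued.v (μa + μb * R₀) = Valued.v ϖ ^ m ∧ Valued.v (μb * γ₀) = Valued.v ϖ ^ m ∧
      σ α₁ = α₁ ∧ Valued.v α₁ = 1 ∧ σ γ₁ = γ₁ ∧ Valued.v γ₁ = 1 ∧ Valued.v γ₁ ≤ 1 ∧
      (∀ V : E, σ V = V → Valued.v V ≤ 1 → Valued.v (μa + μb * (R₀ + V * γ₀)) = Valued.v ϖ ^ (2 * b + d % 2) → Valued.v (α₁ + γ₁ * V) = 1) ∧
      (∀ V : E, σ V = V → Valued.v V ≤ 1 → Valued.v (α₁ + γ₁ * V) = 1 → Valued.v (μa + μb * (R₀ + V * γ₀)) = Valued.v ϖ ^ (2 * b + d % 2)) ∧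
      ∀ (T W f : E), σ T = T → Valued.v T = 1 → σ W = W → Valued.v W ≤ 1 → σ f = f →
        Valued.v ((μa + μb * R₀) * ((ϖ * σ ϖ) ^ b)⁻¹ + μb * γ₀ * ((ϖ * σ ϖ) ^ b)⁻¹ * W) = Valued.v ((μa + μb * R₀) * ((ϖ * σ ϖ) ^ b)⁻¹) →
        Valued.v (T * ((μa + μb * R₀) * ((ϖ * σ ϖ) ^ b)⁻¹ + μb * γ₀ * ((ϖ * σ ϖ) ^ b)⁻¹ * W) - f * ((ϖ - σ ϖ) * ((ϖ * σ ϖ) ^ ((d - d % 2) / 2))⁻¹)) ≤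
          Valued.v ϖ ^ mstarOfRecord d → normSign σ f = normSign σ T * normSign σ (α₁ + γ₁ * W) := by
  obtain ⟨hσσ, hvσ, hϖ, -, -, -, -⟩ := id hD
  have hρj : ∀ c : E, ρ (jE c) = jE c := fun c => (hjfix _).2 ⟨c, rfl⟩
  have hϖ0 : ϖ ≠ 0 := fun h0 => by rw [h0, map_zero] at hϖ; exact (exp_ne_zero hϖ.symm).elim
  have hϖn : ∀ n : ℕ, Valued.v ϖ ^ n = exp (-(n : ℤ)) := fun n => by rw [hϖ, ← exp_nsmul, nsmul_eq_mul, mul_neg, mul_one]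
  have hπn : ∀ n : ℕ, Valued.v (jE ϖ) ^ n = exp (-(n : ℤ)) := fun n => by rw [hjiso, hϖn]
  -- the reference pair of the TOP size `exp 2N`
  obtain ⟨κ₀, ξ₀, hκ₀, hΘκ₀, hξ, hΘξ, hξ0, hκ₀1, hξv⟩ :=
    exists_refPair_of_frame hD jE hjiso hjfix hΘj hρρ hvρ hΘρ hα1 hU hDM hq hσres hτ N
  have hξv' : Valued.v ξ₀ = exp (2 * (N : ℤ)) := by rw [hξv]
  -- a trace-one element has size at least `1` (★ `…SphereCellGenerator.one_le_v_of_trace_one`, three lines, inlined), hence `|κ₀| = 1`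
  have hκ₀v : Valued.v κ₀ = 1 := by
    have h := Valuation.map_add Valued.v κ₀ (ρ κ₀)
    rw [hκ₀, Valuation.map_one, hvρ, max_self] at h
    exact le_antisymm hκ₀1 h
  -- the `(1, α)`-coordinates of `μ`
  set μ : M := lam - jE u00 with hμ
  have hμ1 : Valued.v μ ≤ 1 := by rw [hm, ← exp_zero]; exact exp_le_exp.2 (by omega)
  obtain ⟨μa, μb, -, -, hμab⟩ := exists_eq_map_add_map_mul_of_v_le_one hρρ hα hα1 hint jE hjfix hμ1
  -- `R₀`, `γ₀` by pull-back along `Fix ρ = jE(E)`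
  obtain ⟨R₀, hR₀⟩ := (hjfix (α * κ₀ + ρ (α * κ₀))).1 (by rw [map_add, hρρ, add_comm])
  obtain ⟨γ₀, hγ₀⟩ := (hjfix (ξ₀ * (α - ρ α))).1 (by rw [map_mul, hξ, map_sub, hρρ]; ring)
  -- SIZE 1: `|μa + μb R₀| = |Tr_ρ(μκ₀)| = exp(−m)`
  have hâE : jE (μa + μb * R₀) = μ * κ₀ + ρ (μ * κ₀) := by
    have hρκ : ρ κ₀ = 1 - κ₀ := by rw [← hκ₀]; ring
    rw [map_add, map_mul, hR₀, hμab]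
    simp only [map_add, map_mul, hρj, hρκ]
    ring
  have hâv : Valued.v (μa + μb * R₀) = Valued.v ϖ ^ m := by
    rw [← hjiso, hâE, v_mul_add_map_mul_eq hvρ hκ₀ hκ₀1 hm hjl (by omega), hϖn]
  -- SIZE 2: `|μb γ₀| = |μ − ρμ|·|ξ₀| = exp(−m)` — the digit term is AS LARGE as the main term
  have hbv : Valued.v (μb * γ₀) = Valued.v ϖ ^ m := by
    rw [← hjiso, map_mul, Valuation.map_mul, v_map_snd_eq jE hρj hU hμab, hjl, hγ₀, Valuation.map_mul, hU, mul_one, hξv', ← exp_add, hϖn]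
    congr 1; omega
  -- the chart identity `|ξ₀|·|jEϖ|^jl = |jEϖ|^m = |jEϖ|^(2b + d%2)`
  have hξjl : Valued.v ξ₀ * Valued.v (jE ϖ) ^ jl = Valued.v (jE ϖ) ^ (2 * b + d % 2) := by
    rw [hξv', hπn, hπn, ← exp_add, hbm]; congr 1; omega
  -- the dictionary at `g = 0` WITH its unit letter (★ p864616 ED. 2 HEAD-U)
  have hPv : Valued.v ((ϖ * σ ϖ) ^ b) = Valued.v ϖ ^ (2 * b) := by rw [Valuation.map_pow, Valuation.map_mul, hvσ, ← pow_two, ← pow_mul, mul_comm]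
  have hP0 : (ϖ * σ ϖ) ^ b ≠ 0 := pow_ne_zero _ (mul_ne_zero hϖ0 (by rw [ne_eq, map_eq_zero_iff σ σ.injective]; exact hϖ0))
  have hPv0 : Valued.v ((ϖ * σ ϖ) ^ b) ≠ 0 := (Valuation.ne_zero_iff _).2 hP0
  have hâ : Valued.v ((μa + μb * R₀) * ((ϖ * σ ϖ) ^ b)⁻¹) = Valued.v ϖ ^ (d % 2) := by
    rw [Valuation.map_mul, map_inv₀, hâv, hPv, ← hbm, pow_add, mul_comm (Valued.v ϖ ^ (2 * b)), mul_assoc, mul_inv_cancel₀ (by rwa [hPv] at hPv0), mul_one]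
  have hbh : Valued.v (μb * γ₀ * ((ϖ * σ ϖ) ^ b)⁻¹) = Valued.v ϖ ^ (2 * 0 + d % 2) := by
    rw [Valuation.map_mul, map_inv₀, hbv, hPv, show m = 2 * b + (2 * 0 + d % 2) by omega, pow_add, mul_comm (Valued.v ϖ ^ (2 * b)), mul_assoc,
      mul_inv_cancel₀ (by rwa [hPv] at hPv0), mul_one]
  obtain ⟨α₁, γ₁, hα₁σ, hα₁1, hγ₁σ, hγ₁v, hiff, haff⟩ := exists_affineLabel_of_coords_onShell_iff hD hâ hbh
  have hγ₁v' : Valued.v γ₁ = 1 := by rw [hγ₁v]; simp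
  -- the shell in the socket's currency: `|μa + μb(R₀ + Vγ₀)| = |ϖ|^(2b + d%2)` ↔ `|â′ + b̂′V| = |â′|`
  have hPinv0 : Valued.v (((ϖ * σ ϖ) ^ b)⁻¹) ≠ 0 := by rw [map_inv₀]; exact inv_ne_zero hPv0
  have hshell : ∀ V : E, Valued.v (μa + μb * (R₀ + V * γ₀)) = Valued.v ϖ ^ (2 * b + d % 2) ↔
      Valued.v ((μa + μb * R₀) * ((ϖ * σ ϖ) ^ b)⁻¹ + μb * γ₀ * ((ϖ * σ ϖ) ^ b)⁻¹ * V) = Valued.v ((μa + μb * R₀) * ((ϖ * σ ϖ) ^ b)⁻¹) := by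
    intro V
    have e : (μa + μb * R₀) * ((ϖ * σ ϖ) ^ b)⁻¹ + μb * γ₀ * ((ϖ * σ ϖ) ^ b)⁻¹ * V = (μa + μb * (R₀ + V * γ₀)) * ((ϖ * σ ϖ) ^ b)⁻¹ := by ring
    rw [e, Valuation.map_mul, Valuation.map_mul, hâv, hbm]
    exact ⟨fun h => by rw [h], fun h => mul_right_cancel₀ hPinv0 h⟩
  have hunit' : ∀ V : E, σ V = V → Valued.v V ≤ 1 → Valued.v (μa + μb * (R₀ + V * γ₀)) = Valued.v ϖ ^ (2 * b + d % 2) →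
      Valued.v (α₁ + γ₁ * V) = 1 := fun V hσV hV1 hNX => (hiff V hσV hV1).1 ((hshell V).1 hNX)
  have hconv : ∀ V : E, σ V = V → Valued.v V ≤ 1 → Valued.v (α₁ + γ₁ * V) = 1 →
      Valued.v (μa + μb * (R₀ + V * γ₀)) = Valued.v ϖ ^ (2 * b + d % 2) := fun V hσV hV1 hU1 => (hshell V).2 ((hiff V hσV hV1).2 hU1)
  exact ⟨κ₀, ξ₀, μa, μb, R₀, γ₀, α₁, γ₁, hκ₀, hΘκ₀, hκ₀1, hκ₀v, hξ, hΘξ, hξ0, hξv', hξjl, hμab, hR₀, hγ₀, hâv, hbv, hα₁σ, hα₁1, hγ₁σ, hγ₁v', hγ₁v'.le,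
    hunit', hconv, haff⟩

end Summit.HodgeConjecture.HodgeConjecture.Cruxes.H413.F0P3cDyRamRowTopChartLetters

end
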